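import Literature.AlgebraicGeometry.Resolution.CharPolyhedronVertexPreparationHolds
import Mathlib.Topology.Instances.Real.Lemmas
import HarnessLib

/-!
# A minimal characteristic polyhedron is the minimum — Hironaka's theorem (4.8), PROVED
# (Cossart–Piltant 2019, Prop. 2.2 (2) "if"; Hironaka 1967, Thm. (4.8))

Topic: `Literature/AlgebraicGeometry/Resolution`. PROOF FILE (theorems only; no `def`, no named
fact, no instance) completing `CharPolyhedronSolvableVertex.lean` (Def. 2.3 `IsSolvableVertex`,
Def. 2.4 `IsMinimal`, Prop. 2.2 (2) "only if": `isMinimal_of_forall_subset`) and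
`CharPolyhedronVertexPreparationHolds.lean` (Prop. 2.2 (1): `exists_isMinimal_taylor…`).

Cossart–Piltant 2019 (arXiv:1412.0868 v1, p. 11, Prop. 2.2 (Hironaka)): "Given `X' := X - φ`,
`φ ∈ Ŝ`, `Δ_Ŝ(h; {u_j}_{j ∈ J}; X')` achieves equality in (2.4) [i.e. is the minimum over all
translations, w.r.t. inclusion] if and only if it has no solvable vertex", with proof line "This
is […] [H3] Hironaka's […] theorem (4.8)".  Here the "if" direction is PROVED:

* `IsMinimal.deltaGE_of_deltaGE_taylor` — `u₁, …, u_N ∈ m_S` with (H) in a Noetherian local `S`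
  with `(u)` a radical ideal (e.g. part of a regular system of parameters), `h ∈ S[X]` monic with
  no solvable vertex, `φ ∈ S`, `α > 0`: `δ_α(h(X + φ); u; X) ≥ q ⇒ δ_α(h; u; X) ≥ q`
  (i.e. `δ_α(h; u; X) ≥ δ_α(h; u; X')` for every translate `X' = X - (-φ)`);
* `IsMinimal.charPolyhedron_subset_charPolyhedron_taylor` — hence
  `Δ(h; u; X) ⊆ Δ(h(X + φ); u; X)` for every `φ` (support-function rendering of `Δ`);
* `isMinimal_iff_forall_charPolyhedron_subset` — Prop. 2.2 (2) as an `iff`;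
* `exists_isMinimum_taylor_of_isAdicComplete` and the `IsRsopPart` packaging — Prop. 2.2 (1)
  with the "minimum w.r.t. inclusion" clause, for `S` complete;
* `IsMinimal.charPolyhedron_taylor_eq_empty_iff` — Prop. 2.2 (3) for the ring itself in place
  of `Ŝ`: the minimal polyhedron is empty iff `h = (X - g)^m` for some `g ∈ S` (via (4.8) and
  the tree's Remark 2.1 `charPolyhedron_eq_empty_iff`);
* `IsMinimal.delta_taylor_eq`, `IsMinimal.deltaGE_one_taylor_iff_of_span_eq`,
  `IsMinimal.delta_one_taylor_eq_of_span_eq` / `_of_rsop` — Prop. 2.3, first assertion: the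
  numbers `δ_α` of a minimal polyhedron do not depend on the preparing translation, and `δ_𝟙`
  (the invariant `δ(y)` of Def. 2.5) not on the regular system of parameters either.

Proof (a direct initial-form argument in the one-equation case; Hironaka's own proof, p. 291,
goes through `(u)`-standard bases and the intrinsic polyhedron `Δ(J; u)`).  Let `h' = h(X + φ)` satisfy `δ_α(h') ≥ q` and let `e := min_{b ∈ 𝐒(φ)} |b|_α`.  If
`e ≥ q` then `φ ∈ I_α(q)` and `δ_α ≥ q` passes to `h = h'(X - φ)` (`DeltaGE.taylor_iff`).
Otherwise `ε := q - e > 0` and the coefficients of `h = h'(X - φ)` satisfy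
`f_{k,X} ≡ C(m,k) (-φ)^k  mod I_α(ke + ε)` (`taylor_coeff_sub_choose_mul_pow_mem`).  Pick on the
face `M = {b ∈ 𝐒(φ) : |b|_α = e}` the point `b₀` of largest euclidean norm — an exposed point:
`⟨b₀, b⟩ < ⟨b₀, b₀⟩` for `b ∈ M ∖ {b₀}` — and perturb the weight to `α' = α - t b₀`, `t > 0`
small; then `b₀` is the unique minimiser of `|·|_{α'}` on `𝐒(φ)`, with value `e'`.  Writing
`φ = Σ_{b ∈ 𝐒(φ)} γ_b u^b`, one gets `φ^k ∈ (u^{k b₀}) + (u^c : |c|_{α'} > k e')` and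
`φ^k - γ_{b₀}^k u^{k b₀} ∈ (u^c : |c|_{α'} > k e')` (`pow_mem_span_face`, `pow_sub_mem_span_off`),
so `f_{k,X} = C(m,k) (-γ_{b₀})^k u^{k b₀} + ρ_k` with `ρ_k` in a monomial ideal none of whose
generators divides `u^{k b₀}`.  An ISOLATION LEMMA (`mem_minExponents_of_isolated`,
`coeffClass_eq_of_isolated`: if `f = s u^c + ρ` with `ρ ∈ (u^b : b ∈ B)`, no `b ∈ B` below `c`,
then `γ̄(f, c) = s̄`, and `c ∈ 𝐒(f)` when `s ∉ (u)`) then shows that `b₀` is a vertex of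
`Δ(h; u; X)` for the weight `α'` (the generating point `m b₀ / m`, as `γ_{b₀}^m ∉ (u)` — this is
where `(u)` radical is used) and that it is SOLVABLE with `λ = γ_{b₀}`:
`γ̄(f_{k,X}, k b₀) = C(m,k) (-γ̄_{b₀})^k` — contradicting minimality.

## Sources

* V. Cossart, O. Piltant, *Resolution of singularities of arithmetical threefolds*, J. Algebra
  529 (2019) 268–535 = arXiv:1412.0868 v1, Ch. 2, p. 9 ((2.1)–(2.3)), p. 10 (Prop. 2.1,
  Def. 2.1–2.2), p. 11 (Def. 2.3, Prop. 2.2 (Hironaka), Def. 2.4). [CossartPiltant2019]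
* Journal numbering (J. Algebra 529, the version of record of [CossartPiltant2019]; held text
  `paper:cossart2019-resolution-singularities-arithmetical-threefolds`, read on the page): arXiv v1
  Def. 2.3 (solvable vertices) = J Def. 2.6, p. 287; v1 Prop. 2.2 (Hironaka) = J Prop. 2.7
  (Hironaka), p. 287 (proof line: "[47] Hironaka's Vertex Preparation Lemma (3.10) and Theorem
  (4.8), and [32] Lemma II.1"); v1 Def. 2.4 (minimal) = J Def. 2.8, p. 287; v1 Prop. 2.3 =
  J Prop. 2.10, p. 288; v1 Def. 2.5 (`δ(y)`) = J Def. 2.11, p. 289; v1 Prop. 2.4 ([CoP3]) =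
  J Prop. 2.12, p. 289.  "arXiv v1 p. N" in this file is page N of the held arXiv text layer
  `paper:arxiv-1412.0868` (concordance: res-lit-6, DIM3-INDEX §24 (h)).
* H. Hironaka, *Characteristic polyhedra of singularities*, J. Math. Kyoto Univ. 7 (1967)
  251–293 (held: `paper:doi-10-1215-kjm-1250524227`; read on the page), Thm. (4.8), p. 291:
  "Let `f` be a `(u)`-standard base of `J`, and `y` a system satisfying (1.2). Assume that
  `(J, u)` satisfies (4.7). If `v` is any vertex of `Δ(f; u; y)` such that `(f; y)` is
  `v`-prepared with respect to `u`, then `v` is also a vertex of `Δ(J; u)`. In particular, if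
  `(f; y)` is totally prepared with respect to `u`, then `Δ(f; u; y) = Δ(J; u)`" — where
  `Δ(J; u)` is the intrinsic polyhedron of the ideal and `Δ(f; u; y) ⊇ Δ(J; u)` always ((3.2),
  p. 275); the one-equation case `J = (h)`, `y = X`, compared over the translates
  `X' = X - φ`, is Cossart–Piltant's Prop. 2.2 (2). [Hironaka1967]
-/

noncomputable section

open Finset Polynomial IsLocalRing

namespace Literature.AlgebraicGeometry.Resolution.CossartPiltant

universe u

variable {S : Type u} [CommRing S] {N : ℕ}

/-! ## Isolation: a monomial not divisible by the other generators -/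

/-- A monomial `u^d` with `d ≠ 0` lies in `(u)`. [folklore] -/
private theorem uPow_mem_span_range_of_ne_zero' (u : Fin N → S) {d : Fin N → ℕ} (hd : d ≠ 0) :
    uPow u d ∈ Ideal.span (Set.range u) := by
  obtain ⟨j, hj⟩ : ∃ j, d j ≠ 0 := by
    by_contra h
    push Not at h
    exact hd (funext h)
  have : uPow u d = u j ^ d j * ∏ i ∈ Finset.univ.erase j, u i ^ d i := by
    unfold uPow
    rw [← Finset.mul_prod_erase _ _ (Finset.mem_univ j)]
  rw [this]
  have hj' : u j ∈ Ideal.span (Set.range u) := Ideal.subset_span ⟨j, rfl⟩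
  exact Ideal.mul_mem_right _ _ (Ideal.pow_mem_of_mem _ hj' _ (Nat.pos_of_ne_zero hj))

/-- **Colon by an isolated monomial**: if `z u^c ∈ (u^b : b ∈ B)` and no `b ∈ B` lies below `c`,
then `z ∈ (u)` (in a family satisfying (H)). [cite: CossartPiltant2019, Prop. 2.1 (arXiv v1 p. 10)] -/
theorem mem_span_range_of_mul_uPow_mem (u : Fin N → S)
    (H : ∀ (i : Fin N) (T : Finset (Fin N)), i ∉ T →
      ∀ y, u i * y ∈ Ideal.span (u '' ↑T) → y ∈ Ideal.span (u '' ↑T))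
    {B : Set (Fin N → ℕ)} {c : Fin N → ℕ} (hB : ∀ b ∈ B, ¬ b ≤ c) {z : S}
    (hz : z * uPow u c ∈ Ideal.span (uPow u '' B)) : z ∈ Ideal.span (Set.range u) := by
  rw [mul_comm] at hz
  have hz' := (uPow_mul_mem_span_uPow_iff u H B c).mp hz
  refine (Ideal.span_le.mpr ?_) hz'
  rintro _ ⟨_, ⟨b, hb, rfl⟩, rfl⟩
  refine uPow_mem_span_range_of_ne_zero' u fun h0 => hB b hb ?_
  intro j
  have h0' : b - c = 0 := h0
  have : (b - c) j = 0 := by rw [h0']; rfl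
  exact tsub_eq_zero_iff_le.mp this

/-- **Isolation lemma, membership**: if `f = s u^c + ρ` with `ρ ∈ (u^b : b ∈ B)`, no `b ∈ B`
below `c`, and `s ∉ (u)`, then `c ∈ 𝐒(f)`. [cite: CossartPiltant2019, Prop. 2.1 (arXiv v1 p. 10)] -/
theorem mem_minExponents_of_isolated [IsNoetherianRing S] [IsLocalRing S] (u : Fin N → S)
    (H : ∀ (i : Fin N) (T : Finset (Fin N)), i ∉ T →
      ∀ y, u i * y ∈ Ideal.span (u '' ↑T) → y ∈ Ideal.span (u '' ↑T))
    (hu : ∀ i, u i ∈ maximalIdeal S) {f s ρ : S} {c : Fin N → ℕ} {B : Set (Fin N → ℕ)}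
    (hf : f = s * uPow u c + ρ) (hρ : ρ ∈ Ideal.span (uPow u '' B)) (hB : ∀ b ∈ B, ¬ b ≤ c)
    (hs : s ∉ Ideal.span (Set.range u)) : c ∈ minExponents u f := by
  obtain ⟨hA, hfA, hmin⟩ := minExponents_spec' u H hu f
  -- some element of `𝐒(f)` lies below `c`
  have hex : ∃ a ∈ minExponents u f, a ≤ c := by
    by_contra hne
    push Not at hne
    apply hs
    refine mem_span_range_of_mul_uPow_mem u H (B := ↑(minExponents u f) ∪ B) (c := c) ?_ ?_
    · rintro b (hb | hb)
      · exact hne b (Finset.mem_coe.mp hb)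
      · exact hB b hb
    · have : s * uPow u c = f - ρ := by rw [hf]; ring
      rw [this, Set.image_union, Ideal.span_union]
      exact sub_mem (Ideal.mem_sup_left hfA) (Ideal.mem_sup_right hρ)
  obtain ⟨a, ha, hac⟩ := hex
  -- and it lies above `c` or above some `b ∈ B`; the latter is impossible
  have hfB : f ∈ Ideal.span (uPow u '' ({c} ∪ B)) := by
    rw [hf, Set.image_union, Ideal.span_union]
    refine add_mem (Ideal.mem_sup_left (Ideal.mul_mem_left _ _ ?_)) (Ideal.mem_sup_right hρ)
    exact Ideal.subset_span ⟨c, rfl, rfl⟩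
  obtain ⟨b, hb, hba⟩ := hmin _ hfB a ha
  rcases hb with hb | hb
  · rw [Set.mem_singleton_iff] at hb
    subst hb
    have : a = b := le_antisymm hac hba
    subst this
    exact ha
  · exact absurd (hba.trans hac) (hB b hb)

/-- **Isolation lemma, coefficient class**: if `f = s u^c + ρ` with `ρ ∈ (u^b : b ∈ B)` and no
`b ∈ B` below `c`, then `γ̄(f, c) = s̄` in `S/(u)` (both sides vanish when `s ∈ (u)`).
[cite: CossartPiltant2019, Prop. 2.1 (ii) (arXiv v1 p. 10)] -/
theorem coeffClass_eq_of_isolated [IsNoetherianRing S] [IsLocalRing S] (u : Fin N → S)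
    (H : ∀ (i : Fin N) (T : Finset (Fin N)), i ∉ T →
      ∀ y, u i * y ∈ Ideal.span (u '' ↑T) → y ∈ Ideal.span (u '' ↑T))
    (hu : ∀ i, u i ∈ maximalIdeal S) {f s ρ : S} {c : Fin N → ℕ} {B : Set (Fin N → ℕ)}
    (hf : f = s * uPow u c + ρ) (hρ : ρ ∈ Ideal.span (uPow u '' B)) (hB : ∀ b ∈ B, ¬ b ≤ c) :
    coeffClass u f c = Ideal.Quotient.mk _ s := by
  classical
  obtain ⟨hA, hfA, hmin⟩ := minExponents_spec' u H hu f
  by_cases hc : c ∈ minExponents u f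
  · obtain ⟨γ, hγ⟩ := exists_expansion_minExponents u hfA
    rw [coeffClass_eq_mk u H hA hγ hc, Ideal.Quotient.eq]
    -- `(γ_c - s) u^c` lies in the monomial ideal of `(𝐒(f) ∖ {c}) ∪ B`
    refine mem_span_range_of_mul_uPow_mem u H (B := ↑((minExponents u f).erase c) ∪ B)
      (c := c) ?_ ?_
    · rintro b (hb | hb)
      · obtain ⟨hbc, hbA⟩ := Finset.mem_erase.mp (Finset.mem_coe.mp hb)
        exact fun hle => hbc (hA.eq (Finset.mem_coe.mpr hbA) (Finset.mem_coe.mpr hc) hle)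
      · exact hB b hb
    · have hsplit := Finset.add_sum_erase (minExponents u f) (fun b => γ b * uPow u b) hc
      have : (γ c - s) * uPow u c = ρ - ∑ b ∈ (minExponents u f).erase c, γ b * uPow u b := by
        have h1 : γ c * uPow u c + ∑ b ∈ (minExponents u f).erase c, γ b * uPow u b =
            s * uPow u c + ρ := by rw [hsplit, ← hγ, hf]
        linear_combination h1
      rw [this, Set.image_union, Ideal.span_union]
      refine sub_mem (Ideal.mem_sup_right hρ) (Ideal.mem_sup_left ?_)
      exact Submodule.sum_mem _ fun b hb =>
        Ideal.mul_mem_left _ _ (Ideal.subset_span ⟨b, Finset.mem_coe.mpr hb, rfl⟩)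
  · rw [coeffClass_eq_zero_of_not_mem u hc, eq_comm, Ideal.Quotient.eq_zero_iff_mem]
    by_contra hs
    exact hc (mem_minExponents_of_isolated u H hu hf hρ hB hs)

/-! ## Products of monomial ideals; powers of an expansion along an exposed exponent -/

/-- `(u^a : a ∈ A) · (u^b : b ∈ B) ⊆ (u^d : d ∈ D)` as soon as `A + B ⊆ D`. [folklore] -/
private theorem span_uPow_mul_span_uPow_le (u : Fin N → S) {A B D : Set (Fin N → ℕ)}
    (h : ∀ a ∈ A, ∀ b ∈ B, a + b ∈ D) :
    Ideal.span (uPow u '' A) * Ideal.span (uPow u '' B) ≤ Ideal.span (uPow u '' D) := by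
  rw [Ideal.span_mul_span']
  apply Ideal.span_le.mpr
  rintro _ ⟨_, ⟨a, ha, rfl⟩, _, ⟨b, hb, rfl⟩, rfl⟩
  show uPow u a * uPow u b ∈ _
  rw [← uPow_add]
  exact Ideal.subset_span ⟨a + b, h a ha b hb, rfl⟩

/-- An expansion `φ = Σ_{b ∈ P} γ_b u^b` with `b₀` the unique minimiser of `|·|_{α'}` on `P` lies in
`(u^{b₀}) + (u^c : |c|_{α'} > |b₀|_{α'})`. [folklore] -/
private theorem mem_span_face_one (u : Fin N → S) {α' : Fin N → ℝ} {P : Finset (Fin N → ℕ)}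
    {γ : (Fin N → ℕ) → S} {φ : S} (hφ : φ = ∑ b ∈ P, γ b * uPow u b) {b₀ : Fin N → ℕ}
    (hmin : ∀ b ∈ P, b ≠ b₀ → weight α' b₀ < weight α' b) :
    φ ∈ Ideal.span (uPow u '' {c | c = b₀ ∨ weight α' b₀ < weight α' c}) := by
  rw [hφ]
  refine Submodule.sum_mem _ fun b hb => Ideal.mul_mem_left _ _ (Ideal.subset_span ⟨b, ?_, rfl⟩)
  by_cases hbb : b = b₀
  · exact Or.inl hbb
  · exact Or.inr (hmin b hb hbb)

/-- **Powers of an expansion along an exposed exponent, face part.** If `φ = Σ_{b ∈ P} γ_b u^b`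
and `b₀ ∈ P` is the unique minimiser of the weight `|·|_{α'}` on `P`, with value `e'`, then
`φ^k ∈ (u^{k b₀}) + (u^c : |c|_{α'} > k e')`. [folklore] -/
private theorem pow_mem_span_face (u : Fin N → S) {α' : Fin N → ℝ} {P : Finset (Fin N → ℕ)}
    {γ : (Fin N → ℕ) → S} {φ : S} (hφ : φ = ∑ b ∈ P, γ b * uPow u b) {b₀ : Fin N → ℕ}
    (hmin : ∀ b ∈ P, b ≠ b₀ → weight α' b₀ < weight α' b) (k : ℕ) :
    φ ^ k ∈ Ideal.span (uPow u ''
      {c | c = k • b₀ ∨ (k : ℝ) * weight α' b₀ < weight α' c}) := by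
  induction k with
  | zero =>
    rw [pow_zero, ← uPow_zero u]
    exact Ideal.subset_span ⟨0, Or.inl (by rw [zero_smul]), rfl⟩
  | succ k ih =>
    rw [pow_succ]
    refine span_uPow_mul_span_uPow_le u ?_ (Ideal.mul_mem_mul ih (mem_span_face_one u hφ hmin))
    rintro a (rfl | ha) b (hb0 | hb)
    · exact Or.inl (by rw [hb0, succ_nsmul])
    · right
      show ((k + 1 : ℕ) : ℝ) * weight α' b₀ < weight α' (k • b₀ + b)
      rw [weight_add, weight_nsmul, Nat.cast_succ]
      linarith
    · right
      show ((k + 1 : ℕ) : ℝ) * weight α' b₀ < weight α' (a + b)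
      have ha' : (k : ℝ) * weight α' b₀ < weight α' a := ha
      rw [hb0, weight_add, Nat.cast_succ]
      linarith
    · right
      show ((k + 1 : ℕ) : ℝ) * weight α' b₀ < weight α' (a + b)
      have ha' : (k : ℝ) * weight α' b₀ < weight α' a := ha
      rw [weight_add, Nat.cast_succ]
      linarith

/-- **Powers of an expansion along an exposed exponent, off-face part**: with the notation of
`pow_mem_span_face`, `φ^k - γ_{b₀}^k u^{k b₀} ∈ (u^c : |c|_{α'} > k e')`. [folklore] -/
private theorem pow_sub_mem_span_off (u : Fin N → S) {α' : Fin N → ℝ} {P : Finset (Fin N → ℕ)}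
    {γ : (Fin N → ℕ) → S} {φ : S} (hφ : φ = ∑ b ∈ P, γ b * uPow u b) {b₀ : Fin N → ℕ}
    (hb₀ : b₀ ∈ P) (hmin : ∀ b ∈ P, b ≠ b₀ → weight α' b₀ < weight α' b) (k : ℕ) :
    φ ^ k - γ b₀ ^ k * uPow u (k • b₀) ∈ Ideal.span (uPow u ''
      {c | (k : ℝ) * weight α' b₀ < weight α' c}) := by
  classical
  induction k with
  | zero =>
    rw [pow_zero, pow_zero, zero_smul, uPow_zero, one_mul, sub_self]
    exact Ideal.zero_mem _
  | succ k ih =>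
    -- `φ - γ_{b₀} u^{b₀}` lies off the face
    have hoff1 : φ - γ b₀ * uPow u b₀ ∈ Ideal.span (uPow u ''
        {c | weight α' b₀ < weight α' c}) := by
      have : φ - γ b₀ * uPow u b₀ = ∑ b ∈ P.erase b₀, γ b * uPow u b := by
        rw [hφ, ← Finset.add_sum_erase P _ hb₀]
        ring
      rw [this]
      refine Submodule.sum_mem _ fun b hb => Ideal.mul_mem_left _ _ (Ideal.subset_span ⟨b, ?_, rfl⟩)
      obtain ⟨hbb, hbP⟩ := Finset.mem_erase.mp hb
      exact hmin b hbP hbb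
    have hsplit : φ ^ (k + 1) - γ b₀ ^ (k + 1) * uPow u ((k + 1) • b₀) =
        (φ ^ k - γ b₀ ^ k * uPow u (k • b₀)) * φ +
          γ b₀ ^ k * uPow u (k • b₀) * (φ - γ b₀ * uPow u b₀) := by
      rw [succ_nsmul, uPow_add]
      ring
    rw [hsplit]
    refine add_mem ?_ ?_
    · refine span_uPow_mul_span_uPow_le u ?_
        (Ideal.mul_mem_mul ih (mem_span_face_one u hφ hmin))
      rintro a ha b (hb0 | hb)
      · show ((k + 1 : ℕ) : ℝ) * weight α' b₀ < weight α' (a + b)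
        have ha' : (k : ℝ) * weight α' b₀ < weight α' a := ha
        rw [hb0, weight_add, Nat.cast_succ]
        linarith
      · show ((k + 1 : ℕ) : ℝ) * weight α' b₀ < weight α' (a + b)
        have ha' : (k : ℝ) * weight α' b₀ < weight α' a := ha
        have hb' : weight α' b₀ < weight α' b := hb
        rw [weight_add, Nat.cast_succ]
        linarith
    · rw [mul_assoc]
      refine Ideal.mul_mem_left _ _ ?_
      have hk : uPow u (k • b₀) ∈ Ideal.span (uPow u '' {k • b₀}) :=
        Ideal.subset_span ⟨k • b₀, rfl, rfl⟩
      refine span_uPow_mul_span_uPow_le u ?_ (Ideal.mul_mem_mul hk hoff1)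
      rintro a ha b hb
      rw [Set.mem_singleton_iff] at ha
      subst ha
      show ((k + 1 : ℕ) : ℝ) * weight α' b₀ < weight α' (k • b₀ + b)
      have hb' : weight α' b₀ < weight α' b := hb
      rw [weight_add, weight_nsmul, Nat.cast_succ]
      linarith

/-! ## The coefficients of `h'(X + ψ)` modulo `I_α(ke + ε)` -/

/-- **`f_{k,X'} ≡ C(m,k) ψ^k mod I_α(k e + (q - e))`** for the coefficients of `h'(X + ψ)`, when
`δ_α(h'; u; X) ≥ q` and `ψ ∈ I_α(e)`, `e ≤ q` (expansion (2.3) of v1 p. 9: the other terms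
`C(m-i, k-i) f_{i,X} ψ^{k-i}`, `i ≥ 1`, lie in `I_α(iq + (k-i)e) ⊆ I_α(ke + (q-e))`).
[cite: CossartPiltant2019, Ch. 2 (2.3) and Def. 2.2 (arXiv v1 pp. 9–10)] -/
theorem taylor_coeff_sub_choose_mul_pow_mem {u : Fin N → S} {α : Fin N → ℝ} {h' : S[X]}
    (hh' : h'.Monic) {q e : ℝ} (hqe : e ≤ q) (hΔ : DeltaGE u α h' q) {ψ : S}
    (hψ : ψ ∈ monomialIdeal u α e) {k : ℕ} (hk : k ∈ Finset.Icc 1 h'.natDegree) :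
    (taylor ψ h').coeff (h'.natDegree - k) - (h'.natDegree.choose k : S) * ψ ^ k ∈
      monomialIdeal u α (k * e + (q - e)) := by
  obtain ⟨hk1, hkm⟩ := Finset.mem_Icc.mp hk
  have hdeg : (hasseDeriv (h'.natDegree - k) h').natDegree < k + 1 :=
    lt_of_le_of_lt (natDegree_hasseDeriv_le _ _) (by omega)
  rw [taylor_coeff, eval_eq_sum_range' hdeg, Finset.sum_range_succ, hasseDeriv_coeff]
  have hidx : k + (h'.natDegree - k) = h'.natDegree := by omega
  rw [hidx, show h'.coeff h'.natDegree = 1 from hh', mul_one,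
    Nat.choose_symm_of_eq_add hidx.symm, add_sub_cancel_right]
  refine Submodule.sum_mem _ fun i hi => ?_
  have hik : i < k := Finset.mem_range.mp hi
  rw [hasseDeriv_coeff]
  have hidx' : i + (h'.natDegree - k) = h'.natDegree - (k - i) := by omega
  have hmem : h'.coeff (i + (h'.natDegree - k)) ∈ monomialIdeal u α ((k - i : ℕ) * q) := by
    rw [hidx']
    exact hΔ (k - i) (Finset.mem_Icc.mpr ⟨by omega, by omega⟩)
  have hprod := mul_mem_monomialIdeal_add hmem (pow_mem_monomialIdeal hψ i)
  have hle : (k : ℝ) * e + (q - e) ≤ ((k - i : ℕ) : ℝ) * q + (i : ℝ) * e := by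
    rw [Nat.cast_sub hik.le]
    have h1 : (1 : ℝ) ≤ (k : ℝ) - i := by
      have : i + 1 ≤ k := hik
      have := (Nat.cast_le (α := ℝ)).mpr this
      push_cast at this
      linarith
    nlinarith [mul_nonneg (sub_nonneg.mpr h1) (sub_nonneg.mpr hqe)]
  rw [mul_assoc]
  exact Ideal.mul_mem_left _ _ (monomialIdeal_antitone u α hle hprod)

/-! ## The solvable vertex of a dominated translate -/

/-- For a weight vector `α > 0`: `x ≤ y` and `|y|_α ≤ |x|_α` force `x = y`. [folklore] -/
private theorem eq_of_le_of_weight_le {α : Fin N → ℝ} (hα : ∀ j, 0 < α j) {x y : Fin N → ℕ}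
    (hxy : x ≤ y) (hw : weight α y ≤ weight α x) : x = y := by
  by_contra hne
  obtain ⟨j, hj⟩ : ∃ j, x j ≠ y j := by
    by_contra h
    push Not at h
    exact hne (funext h)
  have hlt : x j < y j := lt_of_le_of_ne (hxy j) hj
  have : weight α x < weight α y := by
    unfold weight
    refine Finset.sum_lt_sum (fun i _ => mul_le_mul_of_nonneg_left (by exact_mod_cast hxy i)
      (hα i).le) ⟨j, Finset.mem_univ j, ?_⟩
    exact mul_lt_mul_of_pos_left (by exact_mod_cast hlt) (hα j)
  linarith

/-- **The solvable vertex of a dominated translate.** Let `u₁, …, u_N ∈ m_S` satisfy (H) in the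
Noetherian local ring `S`, with `(u)` a radical ideal; let `h' ∈ S[X]` be monic of degree
`m ≥ 1` with `δ_α(h'; u; X) ≥ q` for a weight vector `α > 0`, and let `φ ∈ S` have an exponent
`b ∈ 𝐒(φ)` of weight `|b|_α < q` (i.e. `μ_α(φ) < q ≤ δ_α(h'; u; X)`).  Then the polyhedron
`Δ(h'(X - φ); u; X)` has a SOLVABLE vertex (Def. 2.3) — the initial form of `h'(X - φ)` along a
small perturbation of `α` is `(X - γ̄ U^{b₀})^m` for an exposed point `b₀` of the face of least
`α`-weight of `𝐒(φ)`. [cite: CossartPiltant2019, Def. 2.3 and Prop. 2.2 (arXiv v1 p. 11)]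
[cite: Hironaka1967, Thm. (4.8)] -/
theorem exists_isSolvableVertex_taylor_neg [IsNoetherianRing S] [IsLocalRing S] (u : Fin N → S)
    (H : ∀ (i : Fin N) (T : Finset (Fin N)), i ∉ T →
      ∀ y, u i * y ∈ Ideal.span (u '' ↑T) → y ∈ Ideal.span (u '' ↑T))
    (hu : ∀ i, u i ∈ maximalIdeal S) (hrad : (Ideal.span (Set.range u)).IsRadical)
    {h' : S[X]} (hh' : h'.Monic) (hm : 1 ≤ h'.natDegree) {α : Fin N → ℝ} (hα : ∀ j, 0 < α j)
    {q : ℝ} (hΔ : DeltaGE u α h' q) {φ : S} {b : Fin N → ℕ} (hb : b ∈ minExponents u φ)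
    (hbq : weight α b < q) :
    ∃ x : Fin N → ℕ, IsSolvableVertex u (taylor (-φ) h') x := by
  classical
  set m := h'.natDegree with hm_def
  obtain ⟨hPA, hφP, hPmin⟩ := minExponents_spec' u H hu φ
  set P := minExponents u φ with hP_def
  obtain ⟨γ, hγ⟩ := exists_expansion_minExponents u hφP
  have hγu : ∀ b ∈ P, γ b ∉ Ideal.span (Set.range u) := coeff_not_mem_of_minimal u hPA hPmin hγ
  /- Step 1: the face of least `α`-weight of `𝐒(φ)` and its exposed point `b₀`. -/
  obtain ⟨b₁, hb₁P, hb₁min⟩ := Finset.exists_min_image P (weight α) ⟨b, hb⟩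
  set e := weight α b₁ with he_def
  have heP : ∀ b ∈ P, e ≤ weight α b := hb₁min
  have heq : e < q := lt_of_le_of_lt (hb₁min b hb) hbq
  set M := P.filter (fun b => weight α b = e) with hM_def
  obtain ⟨b₀, hb₀M, hb₀max⟩ :=
    Finset.exists_max_image M (fun b => ∑ j, ((b j : ℕ) : ℝ) ^ 2) ⟨b₁, Finset.mem_filter.mpr ⟨hb₁P, rfl⟩⟩
  obtain ⟨hb₀P, hb₀e⟩ := Finset.mem_filter.mp hb₀M
  set Bsq : ℝ := ∑ j, ((b₀ j : ℕ) : ℝ) ^ 2 with hBsq_def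
  have hexp : ∀ b ∈ M, b ≠ b₀ → ∑ j, (b₀ j : ℝ) * b j < Bsq := by
    intro b hbM hne
    have hsq : ∑ j, ((b j : ℕ) : ℝ) ^ 2 ≤ Bsq := hb₀max b hbM
    have hpos : 0 < ∑ j, ((b₀ j : ℝ) - b j) ^ 2 := by
      obtain ⟨j, hj⟩ : ∃ j, b j ≠ b₀ j := by
        by_contra h
        push Not at h
        exact hne (funext h)
      refine lt_of_lt_of_le ?_
        (Finset.single_le_sum (fun i _ => sq_nonneg ((b₀ i : ℝ) - b i)) (Finset.mem_univ j))
      have : ((b₀ j : ℝ) - b j) ≠ 0 := sub_ne_zero.mpr (by exact_mod_cast (Ne.symm hj))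
      positivity
    have hexpand : ∑ j, ((b₀ j : ℝ) - b j) ^ 2 =
        Bsq + ∑ j, ((b j : ℕ) : ℝ) ^ 2 - 2 * ∑ j, (b₀ j : ℝ) * b j := by
      rw [hBsq_def, Finset.mul_sum, ← Finset.sum_add_distrib, ← Finset.sum_sub_distrib]
      refine Finset.sum_congr rfl fun j _ => ?_
      ring
    linarith
  /- Step 2: the perturbed weight `α' = α - t b₀`, `t > 0` small. -/
  set κ : ℝ := ∑ j, (b₀ j : ℝ) / α j with hκ_def
  have hκ : ∀ x : Fin N → ℕ, ∑ j, (b₀ j : ℝ) * x j ≤ κ * weight α x := by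
    intro x
    unfold weight
    rw [Finset.mul_sum]
    refine Finset.sum_le_sum fun j _ => ?_
    have h1 : (b₀ j : ℝ) / α j ≤ κ :=
      Finset.single_le_sum (fun i _ => div_nonneg (Nat.cast_nonneg _) (hα i).le) (Finset.mem_univ j)
    have h2 : (b₀ j : ℝ) * x j = (b₀ j : ℝ) / α j * (α j * x j) := by
      field_simp [(hα j).ne']
    rw [h2]
    exact mul_le_mul_of_nonneg_right h1 (mul_nonneg (hα j).le (Nat.cast_nonneg _))
  have hev : ∀ᶠ t in nhds (0 : ℝ),
      (∀ j, 0 < α j - t * b₀ j) ∧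
      (∀ b ∈ P, e < weight α b → e - t * Bsq < weight α b - t * ∑ j, (b₀ j : ℝ) * b j) ∧
      (∀ k ∈ Finset.Icc 1 m, (k : ℝ) * (e - t * Bsq) < (1 - t * κ) * (k * e + (q - e))) ∧
      0 < 1 - t * κ := by
    refine (Filter.eventually_all.mpr fun j => ?_).and
      (((Filter.eventually_all_finset P).mpr fun b hb => ?_).and
      (((Filter.eventually_all_finset (Finset.Icc 1 m)).mpr fun k hk => ?_).and ?_))
    · exact ContinuousAt.eventually_lt continuousAt_const
        ((by fun_prop : Continuous fun t : ℝ => α j - t * b₀ j).continuousAt) (by simpa using hα j)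
    · by_cases hlt : e < weight α b
      · exact (ContinuousAt.eventually_lt
          ((by fun_prop : Continuous fun t : ℝ => e - t * Bsq).continuousAt)
          ((by fun_prop : Continuous fun t : ℝ =>
            weight α b - t * ∑ j, (b₀ j : ℝ) * b j).continuousAt) (by simpa using hlt)).mono
          fun t ht _ => ht
      · exact Filter.Eventually.of_forall fun t hlt' => absurd hlt' hlt
    · exact ContinuousAt.eventually_lt
        ((by fun_prop : Continuous fun t : ℝ => (k : ℝ) * (e - t * Bsq)).continuousAt)
        ((by fun_prop : Continuous fun t : ℝ => (1 - t * κ) * (k * e + (q - e))).continuousAt)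
        (by simp; linarith)
    · exact ContinuousAt.eventually_lt continuousAt_const
        ((by fun_prop : Continuous fun t : ℝ => 1 - t * κ).continuousAt) (by simp)
  obtain ⟨δ, hδ, hball⟩ := Metric.eventually_nhds_iff.mp hev
  set t : ℝ := δ / 2 with ht_def
  have ht : 0 < t := by positivity
  have htδ : dist t 0 < δ := by
    rw [Real.dist_eq, sub_zero, abs_of_pos ht, ht_def]
    linarith
  obtain ⟨hC1, hC2, hC3, hC4⟩ := hball htδ
  set α' : Fin N → ℝ := fun j => α j - t * b₀ j with hα'_def
  have hα' : ∀ j, 0 < α' j := hC1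
  have hwt : ∀ x : Fin N → ℕ, weight α' x = weight α x - t * ∑ j, (b₀ j : ℝ) * x j := by
    intro x
    simp only [weight, hα'_def, sub_mul, Finset.sum_sub_distrib, Finset.mul_sum, mul_assoc]
  have he' : weight α' b₀ = e - t * Bsq := by
    rw [hwt, hb₀e, hBsq_def]
    congr 2
    exact Finset.sum_congr rfl fun j _ => by ring
  -- `b₀` is the unique minimiser of `|·|_{α'}` on `𝐒(φ)`
  have hmin' : ∀ b ∈ P, b ≠ b₀ → weight α' b₀ < weight α' b := by
    intro b hbP hne
    rw [he', hwt]
    by_cases hbe : weight α b = e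
    · have := mul_lt_mul_of_pos_left (hexp b (Finset.mem_filter.mpr ⟨hbP, hbe⟩) hne) ht
      rw [hbe]
      linarith
    · exact hC2 b hbP (lt_of_le_of_ne (heP b hbP) (Ne.symm hbe))
  -- far monomials stay off the perturbed faces
  have hfar : ∀ k ∈ Finset.Icc 1 m, ∀ x : Fin N → ℕ, (k : ℝ) * e + (q - e) ≤ weight α x →
      (k : ℝ) * weight α' b₀ < weight α' x := by
    intro k hk x hx
    have h1 := hC3 k hk
    have h2 := mul_le_mul_of_nonneg_left (hκ x) ht.le
    have h3 := mul_le_mul_of_nonneg_left hx hC4.le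
    rw [he', hwt]
    nlinarith
  /- Step 3: the coefficients of `h = h'(X - φ)`: `f_k = C(m,k) (-γ_{b₀})^k u^{k b₀} + ρ_k`. -/
  have hφe : φ ∈ monomialIdeal u α e := by
    rw [hγ]
    exact Submodule.sum_mem _ fun b hb =>
      Ideal.mul_mem_left _ _ (uPow_mem_monomialIdeal u (heP b hb))
  have hψ : -φ ∈ monomialIdeal u α e := (Ideal.neg_mem_iff _).mpr hφe
  set B : ℕ → Set (Fin N → ℕ) := fun k =>
    {c | (k : ℝ) * weight α' b₀ < weight α' c} ∪ {x | (k : ℝ) * e + (q - e) ≤ weight α x}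
    with hB_def
  have hBavoid : ∀ k ∈ Finset.Icc 1 m, ∀ c ∈ B k, ¬ c ≤ k • b₀ := by
    rintro k hk c (hc | hc) hle
    · have hc' : (k : ℝ) * weight α' b₀ < weight α' c := hc
      have := weight_mono (fun j => (hα' j).le) hle
      rw [weight_nsmul] at this
      linarith
    · have hc' : (k : ℝ) * e + (q - e) ≤ weight α c := hc
      have := weight_mono (fun j => (hα j).le) hle
      rw [weight_nsmul, hb₀e] at this
      linarith
  have hnat : (taylor (-φ) h').natDegree = m := natDegree_taylor _ _
  have hdecomp : ∀ k ∈ Finset.Icc 1 m, ∃ ρ ∈ Ideal.span (uPow u '' B k),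
      (taylor (-φ) h').coeff (m - k) = (m.choose k : S) * (-γ b₀) ^ k * uPow u (k • b₀) + ρ := by
    intro k hk
    have h1 := taylor_coeff_sub_choose_mul_pow_mem hh' heq.le hΔ hψ hk
    have h2 := pow_sub_mem_span_off u hγ hb₀P hmin' k
    refine ⟨(m.choose k : S) * (-1) ^ k * (φ ^ k - γ b₀ ^ k * uPow u (k • b₀)) +
      ((taylor (-φ) h').coeff (m - k) - (m.choose k : S) * (-φ) ^ k), ?_, ?_⟩
    · rw [hB_def, Set.image_union, Ideal.span_union]
      refine add_mem (Ideal.mem_sup_left (Ideal.mul_mem_left _ _ h2)) (Ideal.mem_sup_right ?_)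
      rw [← monomialIdeal_eq_span_image]
      exact h1
    · rw [neg_pow φ, neg_pow (γ b₀)]
      ring
  /- Step 4: `b₀` is a vertex of `Δ(h; u; X)` for `α'`. -/
  have hkey : ∀ k ∈ Finset.Icc 1 m, ∀ a ∈ minExponents u ((taylor (-φ) h').coeff (m - k)),
      (k : ℝ) * weight α' b₀ ≤ weight α' a ∧
        ((k : ℝ) * weight α' b₀ = weight α' a → a = k • b₀) := by
    intro k hk a ha
    obtain ⟨ρ, hρ, hf⟩ := hdecomp k hk
    obtain ⟨-, -, hmin⟩ := minExponents_spec' u H hu ((taylor (-φ) h').coeff (m - k))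
    have hfmem : (taylor (-φ) h').coeff (m - k) ∈ Ideal.span (uPow u '' ({k • b₀} ∪ B k)) := by
      rw [hf, Set.image_union, Ideal.span_union]
      refine add_mem (Ideal.mem_sup_left (Ideal.mul_mem_left _ _ ?_)) (Ideal.mem_sup_right hρ)
      exact Ideal.subset_span ⟨k • b₀, rfl, rfl⟩
    obtain ⟨c, hc, hca⟩ := hmin _ hfmem a ha
    have hwca : weight α' c ≤ weight α' a := weight_mono (fun j => (hα' j).le) hca
    rcases hc with hc | hc | hc
    · rw [Set.mem_singleton_iff] at hc
      subst hc
      rw [weight_nsmul] at hwca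
      refine ⟨hwca, fun heq' => ?_⟩
      refine eq_of_le_of_weight_le hα' hca ?_ |>.symm
      rw [weight_nsmul]
      linarith
    · have hc' : (k : ℝ) * weight α' b₀ < weight α' c := hc
      exact ⟨by linarith, fun heq' => by linarith⟩
    · have hc' := hfar k hk c hc
      exact ⟨by linarith, fun heq' => by linarith⟩
  have hsm : (m.choose m : S) * (-γ b₀) ^ m ∉ Ideal.span (Set.range u) := by
    rw [Nat.choose_self, Nat.cast_one, one_mul]
    intro hmem
    have : -γ b₀ ∈ Ideal.span (Set.range u) := hrad ⟨m, hmem⟩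
    exact hγu b₀ hb₀P ((Ideal.neg_mem_iff _).mp this)
  have hmS : m • b₀ ∈ minExponents u ((taylor (-φ) h').coeff (m - m)) := by
    obtain ⟨ρ, hρ, hf⟩ := hdecomp m (Finset.mem_Icc.mpr ⟨hm, le_rfl⟩)
    exact mem_minExponents_of_isolated u H hu hf hρ (hBavoid m (Finset.mem_Icc.mpr ⟨hm, le_rfl⟩))
      hsm
  have hmpos : (0 : ℝ) < m := by exact_mod_cast hm
  have hvert : IsVertexFor u (taylor (-φ) h') α' (fun j => (b₀ j : ℝ)) := by
    have hsum : ∑ j, α' j * (b₀ j : ℝ) = weight α' b₀ := rfl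
    unfold IsVertexFor
    rw [hnat, hsum]
    refine ⟨fun k hk a ha => ?_, ⟨m, Finset.mem_Icc.mpr ⟨hm, le_rfl⟩, m • b₀, hmS, ?_⟩⟩
    · have hkpos : (0 : ℝ) < k := by exact_mod_cast (Finset.mem_Icc.mp hk).1
      obtain ⟨hle, heq'⟩ := hkey k hk a ha
      refine ⟨(le_div_iff₀ hkpos).mpr (by linarith), fun hdiv => ?_⟩
      have : (k : ℝ) * weight α' b₀ = weight α' a := by
        rw [← hdiv, mul_div_cancel₀ _ hkpos.ne']
      have ha' := heq' this
      subst ha'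
      funext j
      rw [Pi.smul_apply, smul_eq_mul, Nat.cast_mul, mul_div_cancel_left₀ _ hkpos.ne']
    · funext j
      rw [Pi.smul_apply, smul_eq_mul, Nat.cast_mul, mul_div_cancel_left₀ _ hmpos.ne']
  /- Step 5: solvability with `λ = γ_{b₀}`. -/
  refine ⟨b₀, ⟨α', hα', hvert⟩, γ b₀, fun k hk => ?_⟩
  rw [hnat] at hk ⊢
  obtain ⟨ρ, hρ, hf⟩ := hdecomp k hk
  exact coeffClass_eq_of_isolated u H hu hf hρ (hBavoid k hk)

/-! ## Hironaka's theorem (4.8): no solvable vertex ⇒ minimum -/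

/-- **Hironaka (4.8) / [CP2019] Prop. 2.2 (2) "if", weight by weight.** Let `u₁, …, u_N ∈ m_S`
satisfy (H) in the Noetherian local ring `S`, with `(u)` radical (e.g. part of a regular system of
parameters), and let `h ∈ S[X]` be monic with `Δ(h; u; X)` minimal in the sense of Def. 2.4 (no
solvable vertex).  Then for every `φ ∈ S` and every weight vector `α > 0`,
`δ_α(h(X + φ); u; X) ≥ q ⇒ δ_α(h; u; X) ≥ q`, i.e. `δ_α(h; u; X) ≥ δ_α(h; u; X')` for the translate
`X' = X - (-φ)`. [cite: CossartPiltant2019, Prop. 2.2 (2) and Def. 2.4 (arXiv v1 p. 11)]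
[cite: Hironaka1967, Thm. (4.8)] -/
theorem IsMinimal.deltaGE_of_deltaGE_taylor [IsNoetherianRing S] [IsLocalRing S] {u : Fin N → S}
    (H : ∀ (i : Fin N) (T : Finset (Fin N)), i ∉ T →
      ∀ y, u i * y ∈ Ideal.span (u '' ↑T) → y ∈ Ideal.span (u '' ↑T))
    (hu : ∀ i, u i ∈ maximalIdeal S) (hrad : (Ideal.span (Set.range u)).IsRadical)
    {h : S[X]} (hh : h.Monic) (hmin : IsMinimal u h) (φ : S) {α : Fin N → ℝ}
    (hα : ∀ j, 0 < α j) {q : ℝ} (hq : DeltaGE u α (taylor φ h) q) : DeltaGE u α h q := by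
  by_cases hm : h.natDegree = 0
  · intro i hi
    have := Finset.mem_Icc.mp hi
    omega
  have hm1 : 1 ≤ (taylor φ h).natDegree := by
    rw [natDegree_taylor]
    exact Nat.one_le_iff_ne_zero.mpr hm
  have hhφ : (taylor φ h).Monic := by
    rw [Monic, leadingCoeff_taylor]
    exact hh
  obtain ⟨hPA, hφP, hPmin⟩ := minExponents_spec' u H hu φ
  by_cases hall : ∀ b ∈ minExponents u φ, q ≤ weight α b
  · have hφq : φ ∈ monomialIdeal u α q :=
      (mem_monomialIdeal_iff_of_minimal u (fun j => (hα j).le) hφP hPmin).mpr hall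
    exact (DeltaGE.taylor_iff hh hφq).mp hq
  · push Not at hall
    obtain ⟨b, hb, hbq⟩ := hall
    obtain ⟨x, hx⟩ := exists_isSolvableVertex_taylor_neg u H hu hrad hhφ hm1 hα hq hb hbq
    rw [taylor_taylor, neg_add_cancel, taylor_zero] at hx
    exact absurd hx (hmin x)

/-- **Hironaka (4.8) / [CP2019] Prop. 2.2 (2) "if": a minimal polyhedron is the minimum.** With
`u`, `S` as above and `h` monic with no solvable vertex, `Δ(h; u; X) ⊆ Δ(h(X + φ); u; X)` for
every `φ ∈ S` (polyhedra in the support-function rendering of `charPolyhedron`).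
[cite: CossartPiltant2019, Prop. 2.2 (2) and Def. 2.4 (arXiv v1 p. 11)]
[cite: Hironaka1967, Thm. (4.8)] -/
theorem IsMinimal.charPolyhedron_subset_charPolyhedron_taylor [IsNoetherianRing S] [IsLocalRing S]
    {u : Fin N → S}
    (H : ∀ (i : Fin N) (T : Finset (Fin N)), i ∉ T →
      ∀ y, u i * y ∈ Ideal.span (u '' ↑T) → y ∈ Ideal.span (u '' ↑T))
    (hu : ∀ i, u i ∈ maximalIdeal S) (hrad : (Ideal.span (Set.range u)).IsRadical)
    {h : S[X]} (hh : h.Monic) (hmin : IsMinimal u h) (φ : S) :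
    charPolyhedron u h ⊆ charPolyhedron u (taylor φ h) := fun _ hx =>
  ⟨hx.1, fun α hα q hq => hx.2 α hα q (hmin.deltaGE_of_deltaGE_taylor H hu hrad hh φ hα hq)⟩

/-- **[CP2019] Prop. 2.2 (2) (Hironaka) as an equivalence**: `Δ(h; u; X)` has no solvable vertex
iff it is contained in the polyhedron of every translate `X' = X - θ`.
[cite: CossartPiltant2019, Prop. 2.2 (2) and Def. 2.4 (arXiv v1 p. 11)]
[cite: Hironaka1967, Thm. (4.8)] -/
theorem isMinimal_iff_forall_charPolyhedron_subset [IsNoetherianRing S] [IsLocalRing S]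
    {u : Fin N → S}
    (H : ∀ (i : Fin N) (T : Finset (Fin N)), i ∉ T →
      ∀ y, u i * y ∈ Ideal.span (u '' ↑T) → y ∈ Ideal.span (u '' ↑T))
    (hu : ∀ i, u i ∈ maximalIdeal S) (hrad : (Ideal.span (Set.range u)).IsRadical)
    {h : S[X]} (hh : h.Monic) :
    IsMinimal u h ↔ ∀ θ : S, charPolyhedron u h ⊆ charPolyhedron u (taylor θ h) :=
  ⟨fun hmin θ => hmin.charPolyhedron_subset_charPolyhedron_taylor H hu hrad hh θ,
    isMinimal_of_forall_subset H hu hh⟩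

/-- **Two minimal translates have the same polyhedron** (the minimal `Δ` is well defined,
independently of the preparing translation). [cite: CossartPiltant2019, Prop. 2.2 and Def. 2.4
(arXiv v1 p. 11)] [cite: Hironaka1967, Thm. (4.8)] -/
theorem IsMinimal.charPolyhedron_taylor_eq [IsNoetherianRing S] [IsLocalRing S] {u : Fin N → S}
    (H : ∀ (i : Fin N) (T : Finset (Fin N)), i ∉ T →
      ∀ y, u i * y ∈ Ideal.span (u '' ↑T) → y ∈ Ideal.span (u '' ↑T))
    (hu : ∀ i, u i ∈ maximalIdeal S) (hrad : (Ideal.span (Set.range u)).IsRadical)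
    {h : S[X]} (hh : h.Monic) {θ₁ θ₂ : S} (h₁ : IsMinimal u (taylor θ₁ h))
    (h₂ : IsMinimal u (taylor θ₂ h)) :
    charPolyhedron u (taylor θ₁ h) = charPolyhedron u (taylor θ₂ h) := by
  have hmon : ∀ θ : S, (taylor θ h).Monic := fun θ => by
    rw [Monic, leadingCoeff_taylor]
    exact hh
  apply le_antisymm
  · have := h₁.charPolyhedron_subset_charPolyhedron_taylor H hu hrad (hmon θ₁) (θ₂ - θ₁)
    rwa [taylor_taylor, sub_add_cancel] at this
  · have := h₂.charPolyhedron_subset_charPolyhedron_taylor H hu hrad (hmon θ₂) (θ₁ - θ₂)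
    rwa [taylor_taylor, sub_add_cancel] at this

/-- **[CP2019] Prop. 2.2 (1) with the "minimum" clause**, for `S` complete: `u₁, …, u_N ∈ m_S`
with (H) and `(u)` radical in a complete Noetherian local ring `S`, `h` monic ⇒ there is a
translation `X ↦ X + θ` such that `Δ(h(X + θ); u; X)` has no solvable vertex AND is contained in
`Δ(h(X + θ'); u; X)` for every `θ' ∈ S` ("`Δ_Ŝ(h; u; Z) = min_{X'} Δ_Ŝ(h; u; X')`").
[cite: CossartPiltant2019, Prop. 2.2 (1)–(2) and Def. 2.4 (arXiv v1 p. 11)]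
[cite: Hironaka1967, (3.10) and Thm. (4.8)] -/
theorem exists_isMinimum_taylor_of_isAdicComplete [IsNoetherianRing S] [IsLocalRing S]
    [IsAdicComplete (maximalIdeal S) S] (u : Fin N → S)
    (H : ∀ (i : Fin N) (T : Finset (Fin N)), i ∉ T →
      ∀ y, u i * y ∈ Ideal.span (u '' ↑T) → y ∈ Ideal.span (u '' ↑T))
    (hu : ∀ i, u i ∈ maximalIdeal S) (hrad : (Ideal.span (Set.range u)).IsRadical)
    {h : S[X]} (hh : h.Monic) :
    ∃ θ : S, IsMinimal u (taylor θ h) ∧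
      ∀ θ' : S, charPolyhedron u (taylor θ h) ⊆ charPolyhedron u (taylor θ' h) := by
  obtain ⟨θ, hθ⟩ := exists_isMinimal_taylor_of_isAdicComplete u H hu hh
  refine ⟨θ, hθ, fun θ' => ?_⟩
  have hmon : (taylor θ h).Monic := by
    rw [Monic, leadingCoeff_taylor]
    exact hh
  have := hθ.charPolyhedron_subset_charPolyhedron_taylor H hu hrad hmon (θ' - θ)
  rwa [taylor_taylor, sub_add_cancel] at this

/-! ## Packaging for (parts of) regular systems of parameters -/

/-- **[CP2019] Prop. 2.2 (2) "if" for a part of a regular system of parameters** (`(u)` is then a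
prime ideal): no solvable vertex ⇒ `Δ(h; u; X) ⊆ Δ(h(X + φ); u; X)` for all `φ`.
[cite: CossartPiltant2019, Prop. 2.2 (2) and Def. 2.4 (arXiv v1 p. 11)]
[cite: Hironaka1967, Thm. (4.8)] -/
theorem IsMinimal.charPolyhedron_subset_charPolyhedron_taylor_of_isRsopPart [IsLocalRing S]
    {u : Fin N → S} (hz : IsRsopPart u) {h : S[X]} (hh : h.Monic) (hmin : IsMinimal u h)
    (φ : S) : charPolyhedron u h ⊆ charPolyhedron u (taylor φ h) := by
  haveI := hz.isRegularLocalRing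
  exact hmin.charPolyhedron_subset_charPolyhedron_taylor hz.mem_span_image_of_mul_mem
    hz.mem_maximalIdeal hz.isPrime_span_range.isRadical hh φ

/-- **[CP2019] Prop. 2.2 (2) as an equivalence, for a part of a regular system of parameters.**
[cite: CossartPiltant2019, Prop. 2.2 (2) and Def. 2.4 (arXiv v1 p. 11)]
[cite: Hironaka1967, Thm. (4.8)] -/
theorem isMinimal_iff_forall_charPolyhedron_subset_of_isRsopPart [IsLocalRing S]
    {u : Fin N → S} (hz : IsRsopPart u) {h : S[X]} (hh : h.Monic) :
    IsMinimal u h ↔ ∀ θ : S, charPolyhedron u h ⊆ charPolyhedron u (taylor θ h) := by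
  haveI := hz.isRegularLocalRing
  exact isMinimal_iff_forall_charPolyhedron_subset hz.mem_span_image_of_mul_mem
    hz.mem_maximalIdeal hz.isPrime_span_range.isRadical hh

/-- **[CP2019] Prop. 2.2 (1)–(2) for a part of a regular system of parameters of a complete
regular local ring**: some translate has a polyhedron that is minimal and the minimum.
[cite: CossartPiltant2019, Prop. 2.2 and Def. 2.4 (arXiv v1 p. 11)]
[cite: Hironaka1967, (3.10) and Thm. (4.8)] -/
theorem exists_isMinimum_taylor_of_isRsopPart [IsLocalRing S] [IsAdicComplete (maximalIdeal S) S]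
    {u : Fin N → S} (hz : IsRsopPart u) {h : S[X]} (hh : h.Monic) :
    ∃ θ : S, IsMinimal u (taylor θ h) ∧
      ∀ θ' : S, charPolyhedron u (taylor θ h) ⊆ charPolyhedron u (taylor θ' h) := by
  haveI := hz.isRegularLocalRing
  exact exists_isMinimum_taylor_of_isAdicComplete u hz.mem_span_image_of_mul_mem
    hz.mem_maximalIdeal hz.isPrime_span_range.isRadical hh

/-- Two minimal translates have the same polyhedron, for a part of a regular system of parameters.
[cite: CossartPiltant2019, Prop. 2.2 and Def. 2.4 (arXiv v1 p. 11)] [cite: Hironaka1967, Thm. (4.8)] -/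
theorem IsMinimal.charPolyhedron_taylor_eq_of_isRsopPart [IsLocalRing S] {u : Fin N → S}
    (hz : IsRsopPart u) {h : S[X]} (hh : h.Monic) {θ₁ θ₂ : S} (h₁ : IsMinimal u (taylor θ₁ h))
    (h₂ : IsMinimal u (taylor θ₂ h)) :
    charPolyhedron u (taylor θ₁ h) = charPolyhedron u (taylor θ₂ h) := by
  haveI := hz.isRegularLocalRing
  exact h₁.charPolyhedron_taylor_eq hz.mem_span_image_of_mul_mem hz.mem_maximalIdeal
    hz.isPrime_span_range.isRadical hh h₂

/-! ## Prop. 2.2 (3): the minimal polyhedron is empty iff `h = (X - g)^m` -/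

/-- A monic polynomial all of whose non-leading coefficients `f_{i,X}`, `1 ≤ i ≤ m`, vanish is
`X^m`. [folklore] -/
private theorem eq_X_pow_of_forall_coeff_eq_zero {h : S[X]} (hh : h.Monic)
    (h0 : ∀ i ∈ Finset.Icc 1 h.natDegree, h.coeff (h.natDegree - i) = 0) :
    h = X ^ h.natDegree := by
  ext n
  rw [coeff_X_pow]
  rcases lt_trichotomy n h.natDegree with hlt | heq | hgt
  · rw [if_neg hlt.ne]
    have := h0 (h.natDegree - n) (Finset.mem_Icc.mpr ⟨by omega, by omega⟩)
    rwa [Nat.sub_sub_self hlt.le] at this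
  · rw [if_pos heq, heq]
    exact hh
  · rw [if_neg hgt.ne']
    exact coeff_eq_zero_of_natDegree_lt hgt

/-- **[CP2019] Prop. 2.2 (3), for the ring itself in place of `Ŝ`** (e.g. `S` complete): if
`Δ(h(X + θ); u; X)` is minimal (no solvable vertex; `u` with (H), `(u)` radical), then
`Δ(h(X + θ); u; X) = ∅` iff `h = (X - g)^m` for some `g ∈ S`.  ("⇐" is Hironaka's (4.8):
`Δ(h(X + θ)) ⊆ Δ(h(X + g)) = ∅`; "⇒" is Remark 2.1: `h(X + θ) = X^m`, so `g = θ`.)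
[cite: CossartPiltant2019, Prop. 2.2 (3) and Remark 2.1 (arXiv v1 pp. 10–11)]
[cite: Hironaka1967, Thm. (4.8)] -/
theorem IsMinimal.charPolyhedron_taylor_eq_empty_iff [IsNoetherianRing S] [IsLocalRing S]
    {u : Fin N → S}
    (H : ∀ (i : Fin N) (T : Finset (Fin N)), i ∉ T →
      ∀ y, u i * y ∈ Ideal.span (u '' ↑T) → y ∈ Ideal.span (u '' ↑T))
    (hu : ∀ i, u i ∈ maximalIdeal S) (hrad : (Ideal.span (Set.range u)).IsRadical)
    {h : S[X]} (hh : h.Monic) {θ : S} (hθ : IsMinimal u (taylor θ h)) :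
    charPolyhedron u (taylor θ h) = ∅ ↔ ∃ g : S, h = (X - C g) ^ h.natDegree := by
  have hmon : ∀ η : S, (taylor η h).Monic := fun η => by
    rw [Monic, leadingCoeff_taylor]
    exact hh
  constructor
  · intro hempty
    refine ⟨θ, ?_⟩
    have h0 := (charPolyhedron_eq_empty_iff hu (taylor θ h)).mp hempty
    have hX : taylor θ h = X ^ h.natDegree := by
      have := eq_X_pow_of_forall_coeff_eq_zero (hmon θ) h0
      rwa [natDegree_taylor] at this
    calc h = taylor (-θ) (taylor θ h) := by rw [taylor_taylor, neg_add_cancel, taylor_zero]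
      _ = (X - C θ) ^ h.natDegree := by rw [hX, taylor_X_pow, C_neg, ← sub_eq_add_neg]
  · rintro ⟨g, hg⟩
    have hXg : taylor g h = X ^ h.natDegree := by
      conv_lhs => rw [hg]
      rw [taylor_pow, map_sub, taylor_X, taylor_C, add_sub_cancel_right]
    have hempty : charPolyhedron u (taylor g h) = ∅ := by
      refine (charPolyhedron_eq_empty_iff hu (taylor g h)).mpr fun i hi => ?_
      rw [hXg, natDegree_X_pow] at hi ⊢
      rw [coeff_X_pow, if_neg]
      have := Finset.mem_Icc.mp hi
      omega
    have hsub := hθ.charPolyhedron_subset_charPolyhedron_taylor H hu hrad (hmon θ) (g - θ)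
    rw [taylor_taylor, sub_add_cancel, hempty] at hsub
    exact Set.subset_empty_iff.mp hsub

/-- **[CP2019] Prop. 2.2 (3) for a part of a regular system of parameters.**
[cite: CossartPiltant2019, Prop. 2.2 (3) and Remark 2.1 (arXiv v1 pp. 10–11)]
[cite: Hironaka1967, Thm. (4.8)] -/
theorem IsMinimal.charPolyhedron_taylor_eq_empty_iff_of_isRsopPart [IsLocalRing S]
    {u : Fin N → S} (hz : IsRsopPart u) {h : S[X]} (hh : h.Monic) {θ : S}
    (hθ : IsMinimal u (taylor θ h)) :
    charPolyhedron u (taylor θ h) = ∅ ↔ ∃ g : S, h = (X - C g) ^ h.natDegree := by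
  haveI := hz.isRegularLocalRing
  exact hθ.charPolyhedron_taylor_eq_empty_iff hz.mem_span_image_of_mul_mem hz.mem_maximalIdeal
    hz.isPrime_span_range.isRadical hh

/-! ## Consequences: `δ_α` of a minimal translate is well defined (Prop. 2.3, first assertion) -/

/-- **Two minimal translates have the same `δ_α ≥ q` predicates** (`α > 0`).
[cite: CossartPiltant2019, Prop. 2.2–2.3 (arXiv v1 p. 11)] [cite: Hironaka1967, Thm. (4.8)] -/
theorem IsMinimal.deltaGE_taylor_iff [IsNoetherianRing S] [IsLocalRing S] {u : Fin N → S}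
    (H : ∀ (i : Fin N) (T : Finset (Fin N)), i ∉ T →
      ∀ y, u i * y ∈ Ideal.span (u '' ↑T) → y ∈ Ideal.span (u '' ↑T))
    (hu : ∀ i, u i ∈ maximalIdeal S) (hrad : (Ideal.span (Set.range u)).IsRadical)
    {h : S[X]} (hh : h.Monic) {θ₁ θ₂ : S} (h₁ : IsMinimal u (taylor θ₁ h))
    (h₂ : IsMinimal u (taylor θ₂ h)) {α : Fin N → ℝ} (hα : ∀ j, 0 < α j) (q : ℝ) :
    DeltaGE u α (taylor θ₁ h) q ↔ DeltaGE u α (taylor θ₂ h) q := by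
  have hmon : ∀ θ : S, (taylor θ h).Monic := fun θ => by
    rw [Monic, leadingCoeff_taylor]
    exact hh
  constructor
  · intro hq
    refine h₂.deltaGE_of_deltaGE_taylor H hu hrad (hmon θ₂) (θ₁ - θ₂) hα ?_
    rwa [taylor_taylor, sub_add_cancel]
  · intro hq
    refine h₁.deltaGE_of_deltaGE_taylor H hu hrad (hmon θ₁) (θ₂ - θ₁) hα ?_
    rwa [taylor_taylor, sub_add_cancel]

/-- **Two minimal translates have the same `δ_α(h; u; ·)`** (`α > 0`): the numbers `δ_α` of a
minimal polyhedron do not depend on the preparing translation.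
[cite: CossartPiltant2019, Prop. 2.2–2.3 (arXiv v1 p. 11)] [cite: Hironaka1967, Thm. (4.8)] -/
theorem IsMinimal.delta_taylor_eq [IsNoetherianRing S] [IsLocalRing S] {u : Fin N → S}
    (H : ∀ (i : Fin N) (T : Finset (Fin N)), i ∉ T →
      ∀ y, u i * y ∈ Ideal.span (u '' ↑T) → y ∈ Ideal.span (u '' ↑T))
    (hu : ∀ i, u i ∈ maximalIdeal S) (hrad : (Ideal.span (Set.range u)).IsRadical)
    {h : S[X]} (hh : h.Monic) {θ₁ θ₂ : S} (h₁ : IsMinimal u (taylor θ₁ h))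
    (h₂ : IsMinimal u (taylor θ₂ h)) {α : Fin N → ℝ} (hα : ∀ j, 0 < α j) :
    delta u α (taylor θ₁ h) = delta u α (taylor θ₂ h) := by
  unfold delta
  congr 1
  ext r
  simp only [Set.mem_setOf_eq]
  exact exists_congr fun q => by rw [h₁.deltaGE_taylor_iff H hu hrad hh h₂ hα q]

/-- `δ_𝟙 ≥ q` depends on `u` only through the ideal `(u)` (`I_𝟙(a) = (u)^⌈a⌉`).
[cite: CossartPiltant2019, Ch. 2 (arXiv v1 p. 9: "`ord_{m_S} = μ_𝟙`")] -/
theorem deltaGE_one_iff_of_span_eq {N' : ℕ} {u : Fin N → S} {u' : Fin N' → S}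
    (hspan : Ideal.span (Set.range u) = Ideal.span (Set.range u')) (h : S[X]) (q : ℝ) :
    DeltaGE u (fun _ => (1 : ℝ)) h q ↔ DeltaGE u' (fun _ => (1 : ℝ)) h q := by
  rw [deltaGE_one_iff hspan h q, deltaGE_one_iff rfl h q]

/-- **[CP2019] Prop. 2.3, first assertion (with the tree's rendering of `Ŝ` by the ring itself):
`δ_𝟙(h; u; Z)` for a minimal `Z = X + θ` does not depend on the choice of the family `u`
generating the same ideal nor on the minimal translation** — for `u`, `u'` with
`(u) = (u')` radical, both satisfying (H) inside `m_S`, and `θ`, `θ'` with `Δ(h(X + θ); u; X)` and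
`Δ(h(X + θ'); u'; X)` minimal: `δ_𝟙(h(X + θ); u; X) ≥ q ⟺ δ_𝟙(h(X + θ'); u'; X) ≥ q`.  (Print:
"The rational number `δ_𝟙(h; u₁, …, u_n; Z)` is independent of the r.s.p. `(u₁, …, u_n)` and
`Z = X - θ`, `θ ∈ Ŝ` such that `Δ_Ŝ(h; u₁, …, u_n; Z)` is minimal"; proof as printed:
`μ_𝟙 = ord_{m_S}` for both systems, then minimality = Hironaka (4.8).)
[cite: CossartPiltant2019, Prop. 2.3 (arXiv v1 p. 11)] [cite: Hironaka1967, Thm. (4.8)] -/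
theorem IsMinimal.deltaGE_one_taylor_iff_of_span_eq [IsNoetherianRing S] [IsLocalRing S]
    {N' : ℕ} {u : Fin N → S} {u' : Fin N' → S}
    (H : ∀ (i : Fin N) (T : Finset (Fin N)), i ∉ T →
      ∀ y, u i * y ∈ Ideal.span (u '' ↑T) → y ∈ Ideal.span (u '' ↑T))
    (hu : ∀ i, u i ∈ maximalIdeal S)
    (H' : ∀ (i : Fin N') (T : Finset (Fin N')), i ∉ T →
      ∀ y, u' i * y ∈ Ideal.span (u' '' ↑T) → y ∈ Ideal.span (u' '' ↑T))
    (hu' : ∀ i, u' i ∈ maximalIdeal S) (hrad : (Ideal.span (Set.range u)).IsRadical)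
    (hspan : Ideal.span (Set.range u) = Ideal.span (Set.range u')) {h : S[X]} (hh : h.Monic)
    {θ θ' : S} (hθ : IsMinimal u (taylor θ h)) (hθ' : IsMinimal u' (taylor θ' h)) (q : ℝ) :
    DeltaGE u (fun _ => (1 : ℝ)) (taylor θ h) q ↔ DeltaGE u' (fun _ => (1 : ℝ)) (taylor θ' h) q := by
  have hmon : ∀ η : S, (taylor η h).Monic := fun η => by
    rw [Monic, leadingCoeff_taylor]
    exact hh
  have hrad' : (Ideal.span (Set.range u')).IsRadical := hspan ▸ hrad
  have h1 : ∀ j : Fin N, (0 : ℝ) < (fun _ => (1 : ℝ)) j := fun _ => one_pos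
  have h1' : ∀ j : Fin N', (0 : ℝ) < (fun _ => (1 : ℝ)) j := fun _ => one_pos
  constructor
  · intro hq
    have hq' := (deltaGE_one_iff_of_span_eq hspan _ q).mp hq
    refine hθ'.deltaGE_of_deltaGE_taylor H' hu' hrad' (hmon θ') (θ - θ') h1' ?_
    rwa [taylor_taylor, sub_add_cancel]
  · intro hq
    have hq' := (deltaGE_one_iff_of_span_eq hspan _ q).mpr hq
    refine hθ.deltaGE_of_deltaGE_taylor H hu hrad (hmon θ) (θ' - θ) h1 ?_
    rwa [taylor_taylor, sub_add_cancel]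

/-- **[CP2019] Prop. 2.3, first assertion, for `δ_𝟙` itself**: with hypotheses as in
`IsMinimal.deltaGE_one_taylor_iff_of_span_eq`, `δ_𝟙(h(X + θ); u; X) = δ_𝟙(h(X + θ'); u'; X)` —
the invariant `δ(y)` of Def. 2.5 is well defined.
[cite: CossartPiltant2019, Prop. 2.3 and Def. 2.5 (arXiv v1 pp. 11–12)]
[cite: Hironaka1967, Thm. (4.8)] -/
theorem IsMinimal.delta_one_taylor_eq_of_span_eq [IsNoetherianRing S] [IsLocalRing S]
    {N' : ℕ} {u : Fin N → S} {u' : Fin N' → S}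
    (H : ∀ (i : Fin N) (T : Finset (Fin N)), i ∉ T →
      ∀ y, u i * y ∈ Ideal.span (u '' ↑T) → y ∈ Ideal.span (u '' ↑T))
    (hu : ∀ i, u i ∈ maximalIdeal S)
    (H' : ∀ (i : Fin N') (T : Finset (Fin N')), i ∉ T →
      ∀ y, u' i * y ∈ Ideal.span (u' '' ↑T) → y ∈ Ideal.span (u' '' ↑T))
    (hu' : ∀ i, u' i ∈ maximalIdeal S) (hrad : (Ideal.span (Set.range u)).IsRadical)
    (hspan : Ideal.span (Set.range u) = Ideal.span (Set.range u')) {h : S[X]} (hh : h.Monic)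
    {θ θ' : S} (hθ : IsMinimal u (taylor θ h)) (hθ' : IsMinimal u' (taylor θ' h)) :
    delta u (fun _ => (1 : ℝ)) (taylor θ h) = delta u' (fun _ => (1 : ℝ)) (taylor θ' h) := by
  unfold delta
  congr 1
  ext r
  simp only [Set.mem_setOf_eq]
  exact exists_congr fun q => by
    rw [hθ.deltaGE_one_taylor_iff_of_span_eq H hu H' hu' hrad hspan hh hθ' q]

/-- **[CP2019] Prop. 2.3, first assertion, for two regular systems of parameters** of a regular
local ring `S` (minimal bases `u`, `u'` of `m_S` in the `(hd, u, hu)` format) and two minimal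
translations: `δ_𝟙(h(X + θ); u; X) = δ_𝟙(h(X + θ'); u'; X)`.
[cite: CossartPiltant2019, Prop. 2.3 and Def. 2.5 (arXiv v1 pp. 11–12)]
[cite: Hironaka1967, Thm. (4.8)] -/
theorem IsMinimal.delta_one_taylor_eq_of_rsop [IsRegularLocalRing S] {d d' : ℕ}
    (hd : (maximalIdeal S).spanFinrank = d) (u : Fin d → S)
    (hu : Ideal.span (Set.range u) = maximalIdeal S)
    (hd' : (maximalIdeal S).spanFinrank = d') (u' : Fin d' → S)
    (hu' : Ideal.span (Set.range u') = maximalIdeal S) {h : S[X]} (hh : h.Monic) {θ θ' : S}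
    (hθ : IsMinimal u (taylor θ h)) (hθ' : IsMinimal u' (taylor θ' h)) :
    delta u (fun _ => (1 : ℝ)) (taylor θ h) = delta u' (fun _ => (1 : ℝ)) (taylor θ' h) := by
  have hrad : (Ideal.span (Set.range u)).IsRadical := by
    rw [hu]
    exact (maximalIdeal.isMaximal S).isPrime.isRadical
  exact hθ.delta_one_taylor_eq_of_span_eq (mem_span_image_of_mul_mem_rsop hd u hu)
    (fun i => hu ▸ Ideal.subset_span ⟨i, rfl⟩) (mem_span_image_of_mul_mem_rsop hd' u' hu')
    (fun i => hu' ▸ Ideal.subset_span ⟨i, rfl⟩) hrad (hu.trans hu'.symm) hh hθ'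

end Literature.AlgebraicGeometry.Resolution.CossartPiltant

end
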